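import Summits.PneNP.PneNP.Theorems.ExpanderLinearGeneratorsResolutionNFreeCount
import HarnessLib

/-!
# The n-free resolution-size rung for expanding linear systems, IX: counting ALTERED restrictions

Support file for crux `stmt-PneNP-11442`
(`Summit.PneNP.PneNP.Theses.ExpanderLinearGenerators.ExpansionForcesDepthFregeSize`, the
expansion-scale law, stated uniformly in the numbers `n` of variables and `m` of rows). Files I–IV
proved the n-free POLYNOMIAL resolution-size law `|π| ≥ r^{(1-ε)⌈3ℓ/4⌉}/2^{ℓ+1}` by a
load-bounded random restriction; the exponent is capped by the union bound over overloaded rows.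
Files IX–XII remove that cap for systems of bounded COLUMN WEIGHT (every variable in at most `Δ`
rows) by ALTERATION: instead of discarding a sample with an overloaded row, un-assign the variables
of all overloaded rows. The altered restriction is load-bounded by construction, so file I applies to
EVERY sample; the price is that an assigned variable of a line may be un-assigned ("damaged"), and
this file counts that price abstractly.

Samples are `ω = (u, y)`, `u : Fin n → Fin (K+1)` (variable `j` is assigned iff `u j = 0`),
`y : Fin n → Bool` (its value), as in file II. For an ARBITRARY damage map `Dm` (a set of variables
depending on `u` only), a fixed set `T₀` of variables and prescribed values `b`:

* `card_filter_forall_ne`: functions avoiding one prescribed value on each point of `P` number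
  exactly `(|κ|-1)^{|P|} |κ|^{|ι|-|P|}`;
* `card_fiber_damage_le`: the samples in which every UNDAMAGED assigned `j ∈ T₀` has `y j ≠ b j`
  and at most `t₀` assigned points of `T₀` are damaged form at most a
  `2^{t₀} ((2K+1)/(2K+2))^{|T₀|}` fraction of the space (condition on `u`, count `y` fibrewise, and
  compare with the undamaged product count of file II).

References: P. Beame, T. Pitassi, FOCS 1996 (restriction method); E. Ben-Sasson, A. Wigderson,
J. ACM 48 (2001), §3; N. Alon, J. Spencer, *The probabilistic method*, §3 (alteration).
-/

namespace Summit.PneNP.PneNP.Theorems.ResNFree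

set_option linter.dupNamespace false -- `Summit.PneNP.PneNP.…`: summit = sub-problem (D-0017)

open Finset Literature.Computability.Complexity Literature.Computability.MetaComplexity
open Summit.PneNP.PneNP.Theorems.ResKRestriction

/-! ### An exact product count -/

section Counting

variable {ι κ : Type*} [Fintype ι] [DecidableEq ι] [Fintype κ] [DecidableEq κ]

/-- **Functions avoiding one prescribed value on each point of `P`** number exactly
`(|κ| - 1)^{|P|} |κ|^{|ι| - |P|}` (the set is a `Fintype.piFinset`). [folklore] -/
theorem card_filter_forall_ne (P : Finset ι) (g : ι → κ) :
    ((univ : Finset (ι → κ)).filter fun f => ∀ i ∈ P, f i ≠ g i).card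
      = (Fintype.card κ - 1) ^ P.card * Fintype.card κ ^ (Fintype.card ι - P.card) := by
  classical
  set t : ι → Finset κ := fun i => if i ∈ P then univ.erase (g i) else univ with ht
  have heq : ((univ : Finset (ι → κ)).filter fun f => ∀ i ∈ P, f i ≠ g i) = Fintype.piFinset t := by
    ext f
    simp only [Finset.mem_filter, Finset.mem_univ, true_and, Fintype.mem_piFinset]
    constructor
    · intro h i
      by_cases hi : i ∈ P
      · simp only [ht, if_pos hi]; exact Finset.mem_erase.2 ⟨h i hi, Finset.mem_univ _⟩
      · simp only [ht, if_neg hi]; exact Finset.mem_univ _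
    · intro h i hi
      have h' := h i
      simp only [ht, if_pos hi] at h'
      exact (Finset.mem_erase.1 h').1
  rw [heq, Fintype.card_piFinset]
  have h1 : ∀ i, (t i).card = if i ∈ P then Fintype.card κ - 1 else Fintype.card κ := by
    intro i
    by_cases hi : i ∈ P
    · simp only [ht, if_pos hi, Finset.card_erase_of_mem (Finset.mem_univ _), Finset.card_univ]
    · simp only [ht, if_neg hi, Finset.card_univ]
  simp_rw [h1]
  rw [Finset.prod_ite, Finset.prod_const, Finset.prod_const]
  congr 2
  · rw [Finset.filter_mem_eq_inter, Finset.univ_inter]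
  · rw [Finset.filter_not, Finset.filter_mem_eq_inter, Finset.univ_inter, Finset.card_univ_sdiff]

end Counting

/-! ### Damaged samples, counted fibrewise -/

variable {n : ℕ}

/-- The Boolean functions differing from `b` on a set `Z` number `2^{n - |Z|}`. [folklore] -/
theorem card_filter_forall_ne_bool (Z : Finset (Fin n)) (b : Fin n → Bool) :
    ((univ : Finset (Fin n → Bool)).filter fun y => ∀ j ∈ Z, y j ≠ b j).card = 2 ^ (n - Z.card) := by
  classical
  have h := card_filter_forall_ne Z b
  rw [Fintype.card_bool, Fintype.card_fin, show (2 - 1 : ℕ) = 1 from rfl, one_pow, one_mul] at h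
  rw [← h]
  congr 1
  ext f
  simp

/-- **Damaged samples are still rare (abstract form).** Let `Dm u` be any set of variables
depending on the assignment pattern `u` only ("damaged" variables), `T₀` a set of variables and
`b` prescribed values. The samples `(u, y)` such that every assigned (`u j = 0`) undamaged `j ∈ T₀`
has `y j ≠ b j`, and at most `t₀` assigned points of `T₀` are damaged, form at most a
`2^{t₀} ((2K+1)/(2K+2))^{|T₀|}` fraction of the sample space. [Alon–Spencer, *The probabilistic
method*, §3 (alteration); Beame–Pitassi 1996] [folklore] -/
theorem card_fiber_damage_le {K t₀ : ℕ} (T₀ : Finset (Fin n)) (b : Fin n → Bool)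
    (Dm : (Fin n → Fin (K + 1)) → Finset (Fin n))
    (s : Finset ((Fin n → Fin (K + 1)) × (Fin n → Bool)))
    (hs : ∀ ω ∈ s, (∀ j ∈ T₀, ω.1 j = 0 → j ∉ Dm ω.1 → ω.2 j ≠ b j) ∧
      (T₀.filter fun j => ω.1 j = 0 ∧ j ∈ Dm ω.1).card ≤ t₀) :
    (s.card : ℝ) ≤ (2 : ℝ) ^ t₀ * ((2 * (K : ℝ) + 1) / (2 * K + 2)) ^ T₀.card *
      ((K + 1) ^ n * 2 ^ n : ℕ) := by
  classical
  -- assigned / undamaged-assigned points of `T₀` under `u`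
  set Z : (Fin n → Fin (K + 1)) → Finset (Fin n) := fun u => T₀.filter fun j => u j = 0 with hZ
  set P : (Fin n → Fin (K + 1)) → Finset (Fin n) :=
    fun u => T₀.filter fun j => u j = 0 ∧ j ∉ Dm u with hP
  set Y : (Fin n → Fin (K + 1)) → Finset (Fin n) :=
    fun u => T₀.filter fun j => u j = 0 ∧ j ∈ Dm u with hY
  have hZPY : ∀ u, (Z u).card = (P u).card + (Y u).card := by
    intro u
    have h1 : P u = (Z u).filter fun j => j ∉ Dm u := by
      ext j; simp only [hP, hZ, Finset.mem_filter]; tauto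
    have h2 : Y u = (Z u).filter fun j => ¬ (j ∉ Dm u) := by
      ext j; simp only [hY, hZ, Finset.mem_filter, not_not]; tauto
    rw [h1, h2]
    exact (Finset.card_filter_add_card_filter_not _).symm
  -- (1) the fibre of `s` over `u` has at most `2^{t₀} 2^{n - |Z u|}` points
  have hfib : ∀ u : Fin n → Fin (K + 1),
      ((s.filter fun ω => ω.1 = u).card : ℝ) ≤ (2 : ℝ) ^ t₀ * (2 : ℝ) ^ (n - (Z u).card) := by
    intro u
    rcases (s.filter fun ω => ω.1 = u).eq_empty_or_nonempty with h0 | ⟨ω₀, hω₀⟩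
    · rw [h0, Finset.card_empty, Nat.cast_zero]; positivity
    obtain ⟨hω₀s, hω₀u⟩ := Finset.mem_filter.1 hω₀
    have hYle : (Y u).card ≤ t₀ := by
      have h := (hs ω₀ hω₀s).2
      rw [hω₀u] at h
      exact h
    -- inject the fibre into the Boolean functions avoiding `b` on `P u`
    have hle : (s.filter fun ω => ω.1 = u).card
        ≤ ((univ : Finset (Fin n → Bool)).filter fun y => ∀ j ∈ P u, y j ≠ b j).card := by
      refine Finset.card_le_card_of_injOn (fun ω => ω.2) ?_ ?_
      · intro ω hω
        have hω' := Finset.mem_filter.1 (Finset.mem_coe.1 hω)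
        obtain ⟨hωs, hωu⟩ := hω'
        refine Finset.mem_coe.2 (Finset.mem_filter.2 ⟨Finset.mem_univ _, fun j hj => ?_⟩)
        obtain ⟨hjT, hj0, hjD⟩ := Finset.mem_filter.1 hj
        have h := (hs ω hωs).1 j hjT
        rw [hωu] at h
        exact h hj0 hjD
      · intro ω hω ω' hω' h
        have h1 := (Finset.mem_filter.1 (Finset.mem_coe.1 hω)).2
        have h2 := (Finset.mem_filter.1 (Finset.mem_coe.1 hω')).2
        exact Prod.ext (h1.trans h2.symm) h
    have hPb : ((univ : Finset (Fin n → Bool)).filter fun y => ∀ j ∈ P u, y j ≠ b j).card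
        = 2 ^ (n - (P u).card) := by
      convert card_filter_forall_ne_bool (P u) b using 2
    rw [hPb] at hle
    have hexp : n - (P u).card ≤ t₀ + (n - (Z u).card) := by
      have := hZPY u
      omega
    calc ((s.filter fun ω => ω.1 = u).card : ℝ) ≤ ((2 ^ (n - (P u).card) : ℕ) : ℝ) := by
          exact_mod_cast hle
      _ = (2 : ℝ) ^ (n - (P u).card) := by push_cast; ring
      _ ≤ (2 : ℝ) ^ (t₀ + (n - (Z u).card)) := pow_le_pow_right₀ (by norm_num) hexp
      _ = (2 : ℝ) ^ t₀ * (2 : ℝ) ^ (n - (Z u).card) := pow_add _ _ _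
  -- (2) the undamaged comparison set and its fibres
  set G : Finset ((Fin n → Fin (K + 1)) × (Fin n → Bool)) :=
    univ.filter fun ω => ∀ j ∈ T₀, ω.1 j = 0 → ω.2 j ≠ b j with hG
  have hGfib : ∀ u : Fin n → Fin (K + 1),
      (G.filter fun ω => ω.1 = u).card = 2 ^ (n - (Z u).card) := by
    intro u
    have heq : (G.filter fun ω => ω.1 = u)
        = ((univ : Finset (Fin n → Bool)).filter fun y => ∀ j ∈ Z u, y j ≠ b j).image
            fun y => (u, y) := by
      ext ω
      simp only [hG, hZ, Finset.mem_filter, Finset.mem_univ, true_and, Finset.mem_image]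
      constructor
      · rintro ⟨h, rfl⟩
        exact ⟨ω.2, fun j hj => h j hj.1 hj.2, rfl⟩
      · rintro ⟨y, hy, rfl⟩
        exact ⟨fun j hj h0 => hy j ⟨hj, h0⟩, rfl⟩
    rw [heq, Finset.card_image_of_injective _ (Prod.mk_right_injective u)]
    convert card_filter_forall_ne_bool (Z u) b using 2
  have hGsum : ∑ u : Fin n → Fin (K + 1), (2 : ℝ) ^ (n - (Z u).card) = G.card := by
    have h1 : G.card = ∑ u : Fin n → Fin (K + 1), (G.filter fun ω => ω.1 = u).card :=
      Finset.card_eq_sum_card_fiberwise fun ω _ => Finset.mem_coe.2 (Finset.mem_univ ω.1)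
    rw [h1]
    push_cast
    refine Finset.sum_congr rfl fun u _ => ?_
    rw [hGfib u]
    push_cast
    ring
  -- (3) the undamaged set is a product-avoiding set: at most `(2K+1)^{|T₀|} (2K+2)^{n-|T₀|}`
  have hGcard : G.card ≤ (2 * K + 1) ^ T₀.card * (2 * K + 2) ^ (n - T₀.card) := by
    set g : Fin n → Fin (K + 1) × Bool := fun j => (0, b j) with hg
    have hinj : Set.InjOn (fun ω : (Fin n → Fin (K + 1)) × (Fin n → Bool) =>
        (fun j => (ω.1 j, ω.2 j) : Fin n → Fin (K + 1) × Bool)) ↑G := by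
      intro ω _ ω' _ h
      have h' : ∀ j, (ω.1 j, ω.2 j) = (ω'.1 j, ω'.2 j) := fun j => congrFun h j
      ext j
      · exact congrArg Fin.val (Prod.mk.inj (h' j)).1
      · exact (Prod.mk.inj (h' j)).2
    have hcard : G.card ≤ (Fintype.card (Fin (K + 1) × Bool) - 1) ^ T₀.card *
        Fintype.card (Fin (K + 1) × Bool) ^ (Fintype.card (Fin n) - T₀.card) := by
      rw [← Finset.card_image_of_injOn hinj]
      refine card_le_of_forall_ne T₀ g _ fun f hf => ?_
      obtain ⟨ω, hω, rfl⟩ := Finset.mem_image.1 hf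
      intro j hj heq
      simp only [hg, Prod.mk.injEq] at heq
      exact (Finset.mem_filter.1 hω).2 j hj heq.1 heq.2
    rw [Fintype.card_prod, Fintype.card_fin, Fintype.card_bool, Fintype.card_fin] at hcard
    have e1 : ((K + 1) * 2 - 1 : ℕ) = 2 * K + 1 := by omega
    have e2 : ((K + 1) * 2 : ℕ) = 2 * K + 2 := by ring
    rw [e1, e2] at hcard
    exact hcard
  -- (4) assemble
  have hTn : T₀.card ≤ n := (Finset.card_le_univ _).trans (by rw [Fintype.card_fin])
  have hs1 : (s.card : ℝ) ≤ (2 : ℝ) ^ t₀ * G.card := by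
    have h1 : s.card = ∑ u : Fin n → Fin (K + 1), (s.filter fun ω => ω.1 = u).card :=
      Finset.card_eq_sum_card_fiberwise fun ω _ => Finset.mem_coe.2 (Finset.mem_univ ω.1)
    have h1' : (s.card : ℝ) = ∑ u : Fin n → Fin (K + 1), ((s.filter fun ω => ω.1 = u).card : ℝ) := by
      rw [h1]; push_cast; rfl
    rw [h1', ← hGsum, Finset.mul_sum]
    exact Finset.sum_le_sum fun u _ => hfib u
  have hG' : (G.card : ℝ) ≤ (2 * (K : ℝ) + 1) ^ T₀.card * (2 * (K : ℝ) + 2) ^ (n - T₀.card) := by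
    exact_mod_cast hGcard
  have hratio : (2 * (K : ℝ) + 1) ^ T₀.card * (2 * (K : ℝ) + 2) ^ (n - T₀.card)
      = ((2 * (K : ℝ) + 1) / (2 * K + 2)) ^ T₀.card * (2 * (K : ℝ) + 2) ^ n := by
    rw [div_pow, div_mul_eq_mul_div, eq_div_iff (by positivity), mul_assoc, ← pow_add,
      Nat.sub_add_cancel hTn]
  have hΩ : ((2 * (K : ℝ) + 2)) ^ n = ((K + 1) ^ n * 2 ^ n : ℕ) := by
    push_cast
    rw [← mul_pow]; ring
  calc (s.card : ℝ) ≤ (2 : ℝ) ^ t₀ * G.card := hs1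
    _ ≤ (2 : ℝ) ^ t₀ * ((2 * (K : ℝ) + 1) ^ T₀.card * (2 * (K : ℝ) + 2) ^ (n - T₀.card)) :=
        mul_le_mul_of_nonneg_left hG' (by positivity)
    _ = (2 : ℝ) ^ t₀ * ((2 * (K : ℝ) + 1) / (2 * K + 2)) ^ T₀.card * ((K + 1) ^ n * 2 ^ n : ℕ) := by
        rw [hratio, hΩ]; ring

end Summit.PneNP.PneNP.Theorems.ResNFree
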